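import Mathlib
import HarnessLib
import Summits.HubbardSuperconductivity.Statement
import Literature.MathematicalPhysics.QuantumLattice.DWaveSource
import Literature.Barriers.HubbardSuperconductivity.PureModelStripeCompetition

/-!
# Route `WeakCouplingBCS` — the Assembly (item `stmt-HubbardSuperconductivity-10544`), structural

The assembly item of route `HubbardSuperconductivity/WeakCouplingBCS` (rev ≥ 3) is
`Assembly : WcbcsSsbToTorusLRO → WcbcsBcsConstruction → HubbardSuperconductivity` — bookkeeping:
pure logic over the summit Statement, literally the type of the route's deciding theorem `closes`.

* `WcbcsSsbToTorusLRO` (crux 2, SSB ⇒ LRO transfer): on a weak-coupling window `U ∈ (0, U₁)`, for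
  every `δ ∈ (0, 1/2)` and every chemical potential `μ` whose grand-canonical tracial ground-state
  density of `hubbardTorusWith 2 (L+1) 1 U μ` tends to `1 - δ`, Koma–Tasaki `d`-wave order
  `HasDWaveOrder U μ` forces the summit's matrix `HasDWavePairFieldLROAt U δ`.
* `WcbcsBcsConstruction` (crux 4, constructive BCS ground state): some `δ ∈ (0, 1/2)`, `U₀ > 0`,
  `C > 0` such that every `U ∈ (0, U₀)` has a density-matched `μ` with
  `exp (-C/U²) ≤ dWaveOrderParameter U μ`.

Proof (the body of `closes`): take `U := min U₀ U₁ / 2 ∈ (0, U₀) ∩ (0, U₁)`, the density-matched `μ`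
of crux 4 at `U`; `0 < exp (-C/U²) ≤ dWaveOrderParameter U μ` is `HasDWaveOrder U μ`
(`hasDWaveOrder_iff`); crux 2 gives `HasDWavePairFieldLROAt U δ`; and the summit
`HubbardSuperconductivity := Literature.Hubbard.DWaveSuperconductivityHubbard` is
`∃ U > 0, ∃ δ ∈ Ioo 0 (1/2), HasDWavePairFieldLROAt U δ` by `δ`-unfolding.

DESIGN (as for `Theorems/ThermalWedgeAssemblyStructural.lean` and
`Theorems/BalabanIRAssemblyFrame.lean`): the TYPE is spelled out STRUCTURALLY — the verbatim bodies
of the route decls `WcbcsSsbToTorusLRO` and `WcbcsBcsConstruction` (Theses/WeakCouplingBCS.lean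
rev 4) and the summit constant `_root_.HubbardSuperconductivity` — and this module imports only
`Summits.HubbardSuperconductivity.Statement` and Literature modules, NOT the Theses module: the gate
appends `Assembly_holds := _root_.<this theorem>` to the Theses file by importing this module there,
so a Theses import here would close an import cycle (the route file's header asks for exactly this).
The type is definitionally equal (`δ`-unfolding of the three defs) to
`Summit.HubbardSuperconductivity.HubbardSuperconductivity.Theses.WeakCouplingBCS.Assembly`
(checked against the rev-4 Theses file in a scratch file,
`example : WeakCouplingBCS.Assembly := by exact weakCouplingBCS_assembly_structural`, rc 0).
No analysis, no new definitions.
-/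

namespace Summit.HubbardSuperconductivity.HubbardSuperconductivity.Theorems

/-- **Assembly of route `WeakCouplingBCS` (item `stmt-HubbardSuperconductivity-10544`), stated
structurally**: (crux 2 `WcbcsSsbToTorusLRO`, SSB ⇒ even-torus pair-field LRO on a weak-coupling
window, body verbatim) → (crux 4 `WcbcsBcsConstruction`, density-matched `μ` with
`dWaveOrderParameter U μ ≥ exp (-C/U²)` on a weak-coupling window at one `δ ∈ (0,1/2)`, body
verbatim) → `HubbardSuperconductivity`. Pure logic: `U := min U₀ U₁ / 2`, `exp (-C/U²) > 0` gives
`HasDWaveOrder` (`hasDWaveOrder_iff`), crux 2 gives `HasDWavePairFieldLROAt U δ`, which is the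
summit's matrix at `(U, δ)`. Same term as the route's deciding theorem `closes`. [folklore] -/
theorem weakCouplingBCS_assembly_structural :
    (∃ U₀ : ℝ, 0 < U₀ ∧ ∀ U ∈ Set.Ioo (0:ℝ) U₀, ∀ δ ∈ Set.Ioo (0:ℝ) (1 / 2), ∀ μ : ℝ, Filter.Tendsto (fun L : ℕ => ((Literature.MathematicalPhysics.QuantumLattice.hubbardTorusWith 2 (L + 1) 1 U μ).groundStateFunctional Literature.MathematicalPhysics.QuantumLattice.totalNumber).re / ((L + 1 : ℕ) : ℝ) ^ 2) Filter.atTop (nhds (1 - δ)) → Literature.MathematicalPhysics.QuantumLattice.HasDWaveOrder U μ → Literature.Barriers.HubbardSuperconductivity.HasDWavePairFieldLROAt U δ) →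
    (∃ δ ∈ Set.Ioo (0:ℝ) (1 / 2), ∃ U₀ : ℝ, 0 < U₀ ∧ ∃ C : ℝ, 0 < C ∧ ∀ U ∈ Set.Ioo (0:ℝ) U₀, ∃ μ : ℝ, Filter.Tendsto (fun L : ℕ => ((Literature.MathematicalPhysics.QuantumLattice.hubbardTorusWith 2 (L + 1) 1 U μ).groundStateFunctional Literature.MathematicalPhysics.QuantumLattice.totalNumber).re / ((L + 1 : ℕ) : ℝ) ^ 2) Filter.atTop (nhds (1 - δ)) ∧ Real.exp (-C / U ^ 2) ≤ Literature.MathematicalPhysics.QuantumLattice.dWaveOrderParameter U μ) →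
    _root_.HubbardSuperconductivity := by
  rintro ⟨U₁, hU₁, h2⟩ ⟨δ, hδ, U₀, hU₀, C, _hC, h4⟩
  have hpos : (0 : ℝ) < min U₀ U₁ / 2 := half_pos (lt_min hU₀ hU₁)
  have hlt : min U₀ U₁ / 2 < min U₀ U₁ := half_lt_self (lt_min hU₀ hU₁)
  obtain ⟨μ, hdens, hm⟩ := h4 (min U₀ U₁ / 2) ⟨hpos, lt_of_lt_of_le hlt (min_le_left U₀ U₁)⟩
  have hord : Literature.MathematicalPhysics.QuantumLattice.HasDWaveOrder (min U₀ U₁ / 2) μ :=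
    (Literature.MathematicalPhysics.QuantumLattice.hasDWaveOrder_iff _ _).2
      (lt_of_lt_of_le (Real.exp_pos _) hm)
  have hX : Literature.Barriers.HubbardSuperconductivity.HasDWavePairFieldLROAt (min U₀ U₁ / 2) δ :=
    h2 (min U₀ U₁ / 2) ⟨hpos, lt_of_lt_of_le hlt (min_le_right U₀ U₁)⟩ δ hδ μ hdens hord
  show Literature.Hubbard.DWaveSuperconductivityHubbard
  exact ⟨min U₀ U₁ / 2, hpos, δ, hδ, hX⟩

end Summit.HubbardSuperconductivity.HubbardSuperconductivity.Theorems
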